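/-
Copyright (c) 2026 the pub-hodgecm-mathlib formalisation cell (harness21).  Prover seat hodgecm-mathlib-LH4-p01 (g6): LH4-plan (g6) WORDS #59∕#61∕#64 (P3″) «the two ½-free
Jacobowitz frames» (risk R2 of `F0/P3c/LH4/LH4-p01/g6/CENSUS-M1-flicker-scalars.v1.md` bf2b9cff8e6aee20 §5; consumer F0P3a-p08 (g25) `FlickerClassesTraceFrame`); 2026-09-02.
-/
import Literature.NumberTheory.Rogawski1990.FlickerTorusTraceFrame     -- ★ p851724 (this seat): the trace frame `Q_b`, `twistGram_traceFrame = diag(1,1,−1)`, `twistGram_diag_mul_traceFrame = diag(π,1,−π)`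
import HarnessLib

/-!
# The ½-free JACOBOWITZ FRAMES of the sign patterns `(0,1,1)` and `(1,1,0)` over the trace frame `Q_b`: explicit integral `Φ₃`-orthogonal bases with lengths
# `(1, π, −π)` (no extra seed) and `(π, −π, −1)` (one norm-`(−1)` unit `ε`), their Gram matrices and determinants
# (Jacobowitz 1962 §4, §7; Flicker 1998 §2 Prop. 3 (the conjugators `g₃, g₄`); Rogawski 1990 §3.5–§3.6)

Topic `NumberTheory/Rogawski1990`; namespace `Literature.NumberTheory.Rogawski1990`.  THEOREMS ONLY (no definition, no instance, no notation, no named fact, no `sorry`);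
count-neutral; kernel lane `--supports stmt-HodgeConjecture-24833`.  Cell `pub/hodgecm-mathlib` (D-0151), crux H413 = `stmt-HodgeConjecture-24833`, half A line LH4 (dyadic pay-down;
(D-UNR) PRINT by ruling D74′), LEAD T13-42 price list, FINDING OF RECORD #4 (LH4-plan (g6) WORD #55): Flicker's conjugators `g₃, g₄` (★ `UnitFundamentalLemmaInertFlickerTorus`
:140–:186, entries `½`, `det = −π`) realise the sign patterns `(1,1,0)`, `(0,1,1)` relative to `P₁` through the lengths `(−2π, 2π, 1)`, `(1, −2π, 2π)` — which is exactly where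
`x x̄ = 2`, `y ȳ = −2` enter (★ :268 `normTest_frameThree_iff (hx)`, :292 `normTest_frameFour_iff (hy)`).  THIS FILE gives the ½-free replacements over the trace frame
`Q_b = (1 0 1; 0 1 0; b 0 −σb)` (`b + σb = 1`, ★ p851724, Gram `diag(1,1,−1)`), as explicit INTEGRAL frames (entries polynomial in `b, σb, π` and, for `(1,1,0)` only, a unit `ε`
with `σε·ε = −1`), with their Gram matrices and determinants — risk R2 of the M1 census DISCHARGED.  HONEST READER LABEL: BANKED base layer (consumer: F0P3a-p08 (g25)'s
`FlickerClassesTraceFrame`, in flight); HC_CM is proved only modulo the 7 printed citations (2 remaining named inputs: hLiu418 = stmt-HodgeConjecture-24832, h413 =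
stmt-HodgeConjecture-24833) until rung 0 closes; pure commutative algebra, pays no organ, opens no road.

THE CONSTRUCTION (`H(u,v) = σu₁v₃ + σu₂v₂ + σu₃v₁`, `N z = σz·z`, `b + σb = 1`, `σπ = π`).  (f1) `u₁ = (1,0,b)` has length `1` and `u₁^⊥ = {(x₁, x₂, −σb·x₁)}` with form
`N x₂ − N x₁`, a hyperbolic plane with the ½-free hyperbolic pair `p = (1,1,−σb)`, `q = (−σb, b, σb·σb)` (`H(p,p) = H(q,q) = 0`, `H(p,q) = b + σb = 1`); for σ-fixed `λ`,
`p + λb·q` has length `λ` and `p − λσb·q` is orthogonal to it of length `−λ`.  (f2) PATTERN `(0,1,1)`: `P₍₀₁₁₎ = [u₁ | p + πb·q | p − πσb·q]`, Gram `diag(1, π, −π)` — ratios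
`(1, π, π)` to `Q_b`'s `(1, 1, −1)`, read on «`π ∉ N`» alone; `det = −π(b + σb)³ = −π`.  (f3) PATTERN `(1,1,0)`: `u₃ = (1,0,−σb)` has length `−1` and `u₃^⊥ = {(x₁, x₂, b x₁)}`
with the form `N x₁ + N x₂`, isotropic only through a norm-`(−1)` unit `ε` (which EXISTS at every inert-unramified place at any residue characteristic — units are norms, ★
`UnramifiedQuadraticNormSurjective`; in Flicker's frame it hid inside `y ȳ = −2 = (−1)·2`): hyperbolic pair `p′ = (1, ε, b)`, `q′ = (b, −εσb, b·b)` (`H(p′,p′) = 1 + N ε = 0`,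
`H(q′,q′) = N b − N b = 0`, `H(p′,q′) = b + σb = 1`), `P₍₁₁₀₎ = [p′ + πb·q′ | p′ − πσb·q′ | u₃]`, Gram `diag(π, −π, −1)` — ratios `(π, −π, 1)`, pattern `(1,1,0)` on «`π ∉ N`,
`−1 = N ε ∈ N`»; `det = −πε(b + σb)³ = −πε`.  (No ε-free polynomial frame for `(1,1,0)` exists in general: for `E = ℚ_p(i)`, `p ≡ 3 (4)`, `b = ½`, polynomials in `b` are
rational and have square norms, never `−1`.)  The class literals `P·diag(a,m,c)·P⁻¹` are then unitary by ★ `Automorphic.formCongr_conj_diagonal_eq_of_gram` (diagonal Gram +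
norm-one eigenvalues), over a field where `π ≠ 0` (`isUnit_det_frame011∕110`).

* `twistGram_frame011`, `det_frame011`, `det_frame011_eq_neg`, `isUnit_det_frame011`;
* `twistGram_frame110`, `det_frame110`, `det_frame110_eq_neg`, `isUnit_of_map_mul_eq_neg_one`, `isUnit_det_frame110`.

## References
* [Jacobowitz1962] R. Jacobowitz, *Hermitian forms over local fields*, Amer. J. Math. 84 (1962): §4 (4.2)–(4.4) (orthogonal bases from the trace condition), §7 Thm. 7.1.
* [Flicker1998UnitaryFL] Y. Z. Flicker, *Elementary proof of the fundamental lemma for a unitary group*, Canad. J. Math. 50 (1998), §2 Prop. 3 pp. 78–79 (`g₃`, `g₄`, the four classes).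
* [Rogawski1990] J. D. Rogawski, *Automorphic Representations of Unitary Groups in Three Variables* (1990), §3.5 Prop. 3.5.2 p. 29, §3.6 p. 31 (sign vectors of frames).
-/

set_option autoImplicit false

noncomputable section

open Matrix
open scoped MatrixGroups

namespace Literature.NumberTheory.Rogawski1990

open Literature.NumberTheory.Automorphic

section Ring

variable {R : Type*} [CommRing R] (σ : R →+* R)

/-! ## §1 (f2) Pattern `(0,1,1)`: the frame `P₍₀₁₁₎ = [u₁ | p + πb·q | p − πσb·q]`, Gram `diag(1, π, −π)`, `det = −π` -/

/-- **PATTERN `(0,1,1)` — Gram `diag(1, π, −π)`**: the columns `u₁ = (1,0,b)`, `p + πb·q = (1 − πbσb, 1 + πb², −σb(1 − πbσb))`, `p − πσb·q = (1 + π(σb)², 1 − πbσb, −σb(1 + π(σb)²))`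
of `P₍₀₁₁₎` are `Φ₃`-orthogonal of lengths `1`, `π`, `−π` (`σσ = id`, `b + σb = 1`, `σπ = π`) — ratios `(1, π, π)` to `Q_b`'s `(1, 1, −1)` (★ `twistGram_traceFrame`): the sign
pattern `(0,1,1)` of Flicker's `g₄`-class, ½-free and WITHOUT `y ȳ = −2`. [cite: Jacobowitz1962, §4 (4.2)–(4.4)] [cite: Flicker1998UnitaryFL, §2 Prop. 3 p. 79] [cite: Rogawski1990, §3.5 Prop. 3.5.2 p. 29] -/
theorem twistGram_frame011 (hσσ : ∀ x, σ (σ x) = x) {b : R} (hb : b + σ b = 1) {π : R} (hσπ : σ π = π) :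
    twistGram σ (Matrix.of fun i j : Fin 3 => if i.val + j.val + 1 = 3 then (1 : R) else 0)
        !![(1 : R), 1 - π * b * σ b, 1 + π * σ b * σ b; 0, 1 + π * b * b, 1 - π * σ b * b; b, -(σ b * (1 - π * b * σ b)), -(σ b * (1 + π * σ b * σ b))] =
      !![(1 : R), 0, 0; 0, π, 0; 0, 0, -π] := by
  have hb' : σ b + b = 1 := by rw [add_comm]; exact hb
  rw [twistGram_def]
  ext i j
  fin_cases i <;> fin_cases j <;>
    simp [Matrix.mul_apply, Fin.sum_univ_three, Matrix.of_apply, map_add, map_sub, map_mul, map_neg, hσσ, hσπ] <;> grind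

/-- **`det P₍₀₁₁₎ = −π·(b + σb)³`** (so `= −π` under the trace condition; `N(det) = π²`, matching `det diag(1,π,−π) = −π²·det Φ₃⁻¹`). [cite: Jacobowitz1962, §4 (4.2)–(4.4)] -/
theorem det_frame011 (b π : R) :
    Matrix.det !![(1 : R), 1 - π * b * σ b, 1 + π * σ b * σ b; 0, 1 + π * b * b, 1 - π * σ b * b; b, -(σ b * (1 - π * b * σ b)), -(σ b * (1 + π * σ b * σ b))] =
      -(π * (b + σ b) ^ 3) := by
  simp [Matrix.det_fin_three]; ring

/-- `det P₍₀₁₁₎ = −π` under `b + σb = 1`. [cite: Jacobowitz1962, §4 (4.2)–(4.4)] -/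
theorem det_frame011_eq_neg {b : R} (hb : b + σ b = 1) (π : R) :
    Matrix.det !![(1 : R), 1 - π * b * σ b, 1 + π * σ b * σ b; 0, 1 + π * b * b, 1 - π * σ b * b; b, -(σ b * (1 - π * b * σ b)), -(σ b * (1 + π * σ b * σ b))] = -π := by
  rw [det_frame011, hb, one_pow, mul_one]

/-- `P₍₀₁₁₎` is invertible as soon as `π` is (e.g. over the local FIELD): `IsUnit (det P₍₀₁₁₎)` — so ★ `Automorphic.formCongr_conj_diagonal_eq_of_gram` applies to the class literal
`P₍₀₁₁₎·diag(a,m,c)·P₍₀₁₁₎⁻¹`. [cite: Jacobowitz1962, §7 Thm. 7.1] -/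
theorem isUnit_det_frame011 {b : R} (hb : b + σ b = 1) {π : R} (hπ : IsUnit π) :
    IsUnit (Matrix.det !![(1 : R), 1 - π * b * σ b, 1 + π * σ b * σ b; 0, 1 + π * b * b, 1 - π * σ b * b; b, -(σ b * (1 - π * b * σ b)), -(σ b * (1 + π * σ b * σ b))]) := by
  rw [det_frame011_eq_neg σ hb]
  exact hπ.neg

/-! ## §2 (f3) Pattern `(1,1,0)`: the frame `P₍₁₁₀₎ = [p′ + πb·q′ | p′ − πσb·q′ | u₃]` with a norm-`(−1)` unit `ε`, Gram `diag(π, −π, −1)`, `det = −πε` -/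

/-- **PATTERN `(1,1,0)` — Gram `diag(π, −π, −1)`**: with `σε·ε = −1`, the columns `p′ + πb·q′ = (1 + πb², ε(1 − πbσb), b(1 + πb²))`, `p′ − πσb·q′ = (1 − πbσb, ε(1 + π(σb)²), b(1 − πbσb))`,
`u₃ = (1,0,−σb)` of `P₍₁₁₀₎` are `Φ₃`-orthogonal of lengths `π`, `−π`, `−1` (`σσ = id`, `b + σb = 1`, `σπ = π`) — ratios `(π, −π, 1)` to `Q_b`'s `(1, 1, −1)`: the pattern `(1,1,0)` of
Flicker's `g₃`-class, read on «`π ∉ N`, `−1 = N ε ∈ N`», ½-free and WITHOUT `x x̄ = 2`. [cite: Jacobowitz1962, §4 (4.2)–(4.4)] [cite: Flicker1998UnitaryFL, §2 Prop. 3 p. 79]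
[cite: Rogawski1990, §3.5 Prop. 3.5.2 p. 29; §3.6 p. 31] -/
theorem twistGram_frame110 (hσσ : ∀ x, σ (σ x) = x) {b : R} (hb : b + σ b = 1) {ε : R} (hε : σ ε * ε = -1) {π : R} (hσπ : σ π = π) :
    twistGram σ (Matrix.of fun i j : Fin 3 => if i.val + j.val + 1 = 3 then (1 : R) else 0)
        !![1 + π * b * b, 1 - π * b * σ b, (1 : R); ε * (1 - π * b * σ b), ε * (1 + π * σ b * σ b), 0; b * (1 + π * b * b), b * (1 - π * b * σ b), -σ b] =
      !![π, 0, 0; 0, -π, 0; 0, 0, (-1 : R)] := by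
  have hb' : σ b + b = 1 := by rw [add_comm]; exact hb
  have hε' : ε * σ ε = -1 := by rw [mul_comm]; exact hε
  rw [twistGram_def]
  ext i j
  fin_cases i <;> fin_cases j <;>
    simp [Matrix.mul_apply, Fin.sum_univ_three, Matrix.of_apply, map_add, map_sub, map_mul, map_neg, hσσ, hσπ] <;> grind

/-- **`det P₍₁₁₀₎ = −π·ε·(b + σb)³`** (so `= −πε` under the trace condition; `N(det) = −π²`, matching `det diag(π,−π,−1) = π²`). [cite: Jacobowitz1962, §4 (4.2)–(4.4)] -/
theorem det_frame110 (b ε π : R) :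
    Matrix.det !![1 + π * b * b, 1 - π * b * σ b, (1 : R); ε * (1 - π * b * σ b), ε * (1 + π * σ b * σ b), 0; b * (1 + π * b * b), b * (1 - π * b * σ b), -σ b] =
      -(π * ε * (b + σ b) ^ 3) := by
  simp [Matrix.det_fin_three]; ring

/-- `det P₍₁₁₀₎ = −πε` under `b + σb = 1`. [cite: Jacobowitz1962, §4 (4.2)–(4.4)] -/
theorem det_frame110_eq_neg {b : R} (hb : b + σ b = 1) (ε π : R) :
    Matrix.det !![1 + π * b * b, 1 - π * b * σ b, (1 : R); ε * (1 - π * b * σ b), ε * (1 + π * σ b * σ b), 0; b * (1 + π * b * b), b * (1 - π * b * σ b), -σ b] =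
      -(π * ε) := by
  rw [det_frame110, hb, one_pow, mul_one]

/-- A norm-`(−1)` element is a unit: `σε·ε = −1 ⇒ IsUnit ε` (inverse `−σε`). [cite: Jacobowitz1962, §4 (4.2)–(4.4)] -/
theorem isUnit_of_map_mul_eq_neg_one {ε : R} (hε : σ ε * ε = -1) : IsUnit ε :=
  IsUnit.of_mul_eq_one (-σ ε) (by linear_combination (-1 : R) * hε)

/-- `P₍₁₁₀₎` is invertible as soon as `π` is (`ε` is a unit by `σε·ε = −1`): `IsUnit (det P₍₁₁₀₎)`. [cite: Jacobowitz1962, §7 Thm. 7.1] -/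
theorem isUnit_det_frame110 {b : R} (hb : b + σ b = 1) {ε : R} (hε : σ ε * ε = -1) {π : R} (hπ : IsUnit π) :
    IsUnit (Matrix.det !![1 + π * b * b, 1 - π * b * σ b, (1 : R); ε * (1 - π * b * σ b), ε * (1 + π * σ b * σ b), 0; b * (1 + π * b * b), b * (1 - π * b * σ b), -σ b]) := by
  rw [det_frame110_eq_neg σ hb]
  exact (hπ.mul (isUnit_of_map_mul_eq_neg_one σ hε)).neg

end Ring

end Literature.NumberTheory.Rogawski1990

end
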